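import Mathlib
import HarnessLib

/-!
# Suzuki's criterion for the zeros of real self-reciprocal polynomials, genus `g ≤ 2` (Suzuki 2012, §2.2)

A kernel-checked transcription AND PROOF, for `g = 1` and `g = 2`, of

> M. Suzuki, *On zeros of self-reciprocal polynomials*, arXiv:1211.2953 (2012)
> [Suzuki2012SelfReciprocal]: §1 (def_Pg) `P_g(x) = Σ_{k<g} c_k (x^{2g−k} + x^k) + c_g x^g`, real
> `c`, `c₀ ≠ 0`; §2.2 Theorem 2.4 (all zeros of `P_g` lie on `T = {|z| = 1}` and are simple
> ⟺ `m_{2g−n}(c; log q) > 0` and `m_{2g−n}(c; log q)⁻¹ > 0` for every `1 ≤ n ≤ 2g`, `q > 1`),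
> (rel_mR) `m_{2g−n}(c; log q) = R_{n−1}(c) R_n(c)/(g log q)`, Theorem 2.6 (all zeros on `T` and
> simple ⟺ `R_n(c) > 0` and `R_n(c)⁻¹ > 0` for every `1 ≤ n ≤ 2g`), the printed «small table» of the
> rational functions `R_n` for `g = 1, 2` (`R₀ = R₁ = 1` by definition), and Remark 3 (the control
> example `P₂(x) = 4(x⁴+1) − 16(x³+x) + 23x² = (2x²−3x+2)(2x²−5x+2)`: a zero off `T`, yet
> `m₃ = (2 log q)⁻¹ > 0`, `m₂ = m₁ = 0`, `m₀ = (126 log q)⁻¹ > 0` — «the strict inequalities are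
> essential»).

What is here, exactly:
* `GenusOne.P`, `GenusTwo.P` — (def_Pg) for `g = 1, 2` as polynomials over `ℂ` with real
  coefficients; `OnCircleSimple P` — «all zeros of `P` lie on `T` and are simple», in the tree's
  vocabulary (`P.roots.Nodup ∧ ∀ z ∈ P.roots, ‖z‖ = 1`; see `onCircleSimple_iff_isRoot` for the
  root-multiplicity form).
* `GenusOne.R₂`, `GenusTwo.R₂`, `GenusTwo.R₃`, `GenusTwo.R₄` — the closed forms of the source's small
  table, AS PRINTED; `GenusTwo.m₃ … m₀` — the Hamiltonian entries via (rel_mR) with `L = log q`.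
* **Theorem 2.6 for `g = 1` and `g = 2` PROVED** (`GenusOne.onCircleSimple_iff`,
  `GenusTwo.onCircleSimple_iff`) and Theorem 2.4 for `g = 2` in the `m`-form
  (`GenusTwo.onCircleSimple_iff_m_pos`), by an elementary route (explicit factorisation through the
  Joukowski substitution `y = x + 1/x`, a two-point lemma for unimodular pairs, and real algebra) —
  NOT by the source's route (canonical systems, §§3–6).
* Remark 3's numbers as exact identities (`GenusTwo.R_example`, `GenusTwo.m_example`,
  `GenusTwo.isRoot_two_example`, `GenusTwo.not_onCircleSimple_example`).

Honesty about the table. The source DEFINES `R_n` by the `(4g+2)`-dimensional linear recursion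
(def_m1)/(def_v1)/(def_R) of §2.1–§2.2 and then prints the small table «calculated by hand according
to the definition». This file takes the TABLE as the definition for `g ≤ 2` and does not formalise
the recursion; that the recursion reproduces the table (and the determinant formula of Suzuki, J.
Anal. Math. 136 (2018) = arXiv:1308.0228, Thm 1.1) is the cell's two-lineage exact computation of
record (STEP-0 anchors P1/P2, kit j240121 ‖ j240143, referee-signed `rh-columns/STEP0-PASS.ok`), not a
kernel fact. The criterion CONTENT of the table for `g ≤ 2` — Theorem 2.6 — is proved here from
scratch, which re-verifies those table rows independently of either lineage.

Purpose (cell `run/shared/lean/pub/rh-dbr`, COLUMN 6 DBR, LADDER-RH B-D instrument custody): kernel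
form of the STEP-0 anchors **P1/P2** and of the E↔H dictionary leg S0-E (kit j249560) for `g ≤ 2`
(«Lean record row in certificate form»; companion of `Literature.Analysis.DeBrangesSpaces.
CubicStructureHamiltonian*` = anchor P4). RH-FREE: finite facts about polynomials of degree ≤ 4;
nothing here bears on the Riemann Hypothesis.

## Deliberately NOT here
The recursion (def_m1)/(def_v1)/(def_R) and Lemmas 2.1–2.3, 2.5; Theorem 2.6 for `g ≥ 3` (the
printed `g = 3` row is not transcribed); Theorems 2.7–2.9 (the `q^ω` variants) and §§3–8 (the
canonical systems `H_q`, the de Branges spaces, the proofs).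

## References
* [Suzuki2012SelfReciprocal] M. Suzuki, On zeros of self-reciprocal polynomials, arXiv:1211.2953
  (2012): §1 (def_Pg); §2.2 Thm 2.4, Remarks 2–3, (def_mg), (def_R), (rel_mR), Thm 2.6 and the small
  table for `g = 1, 2`.
* [Suzuki2018InverseProblem] M. Suzuki, An inverse problem for a class of canonical systems and its
  applications to self-reciprocal polynomials, J. Anal. Math. 136 (2018) 273–340 = arXiv:1308.0228:
  §7.5 (the same `δ₂, δ₃, δ₄` for `g = 2`; not restated).
-/

noncomputable section

namespace Literature.Algebra.Polynomial

-- Sub-namespace naming the paper's objects (Suzuki's `P_g`, `R_n`, `m_{2g−n}`).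
namespace SuzukiSelfReciprocal

open _root_.Polynomial _root_.Complex

/-! ## «All zeros lie on `T` and are simple» -/

/-- «All zeros of `P` lie on the unit circle `T` and are simple» in the tree's vocabulary: the root multiset has no repetition and consists of unimodular
numbers. (For `P ≠ 0` this is the root-multiplicity statement `onCircleSimple_iff_isRoot`.)
[cite: Suzuki2012SelfReciprocal, §1 and Thm 2.4/2.6 («all zeros lie on T and simple»)] -/
def OnCircleSimple (P : ℂ[X]) : Prop := P.roots.Nodup ∧ ∀ z ∈ P.roots, ‖z‖ = 1

/-- For `P ≠ 0`: `OnCircleSimple P` iff every root `z` of `P` has `‖z‖ = 1` and root multiplicity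
`1` (unpacking of the definition; `Polynomial.count_roots`). [cite: Suzuki2012SelfReciprocal, §1 and Thm 2.4/2.6 («all zeros lie on T and simple»), multiplicity form] -/
theorem onCircleSimple_iff_isRoot {P : ℂ[X]} (hP : P ≠ 0) :
    OnCircleSimple P ↔ ∀ z, P.IsRoot z → ‖z‖ = 1 ∧ P.rootMultiplicity z = 1 := by
  unfold OnCircleSimple
  rw [Multiset.nodup_iff_count_le_one]
  constructor
  · rintro ⟨hnd, hnorm⟩ z hz
    have hmem : z ∈ P.roots := (mem_roots hP).2 hz
    refine ⟨hnorm z hmem, ?_⟩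
    have h1 : P.rootMultiplicity z ≤ 1 := by rw [← count_roots]; exact hnd z
    have h2 : 0 < P.rootMultiplicity z := (rootMultiplicity_pos hP).2 hz
    omega
  · intro h
    refine ⟨fun z => ?_, fun z hz => (h z ((mem_roots hP).1 hz)).1⟩
    rw [count_roots]
    by_cases hz : P.IsRoot z
    · exact (h z hz).2.le
    · rw [rootMultiplicity_eq_zero hz]; exact zero_le_one

/-! ## Elementary lemmas: Vieta pairs, unimodular pairs -/

/-- Over `ℂ` every pair (sum, product) is realised: `∃ w w', w + w' = s ∧ w w' = p` (quadratic
formula via `IsAlgClosed.exists_pow_nat_eq`). [folklore] -/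
private theorem exists_sum_prod_eq (s p : ℂ) : ∃ w w' : ℂ, w + w' = s ∧ w * w' = p := by
  obtain ⟨d, hd⟩ := IsAlgClosed.exists_pow_nat_eq (s ^ 2 - 4 * p) (by norm_num : 0 < 2)
  refine ⟨(s + d) / 2, (s - d) / 2, by ring, ?_⟩
  have : (s + d) / 2 * ((s - d) / 2) = (s ^ 2 - d ^ 2) / 4 := by ring
  rw [this, hd]; ring

/-- `X² − (w + w')X + w w' = (X − w)(X − w')`. [folklore] -/
private theorem quad_factor (w w' : ℂ) :
    (X ^ 2 - C (w + w') * X + C (w * w') : ℂ[X]) = (X - C w) * (X - C w') := by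
  simp only [map_add, map_mul]; ring

/-- `‖w‖ = 1 ⟺ (Re w)² + (Im w)² = 1`. [folklore] -/
private theorem norm_eq_one_iff_sq (w : ℂ) : ‖w‖ = 1 ↔ w.re ^ 2 + w.im ^ 2 = 1 := by
  have h0 : 0 ≤ ‖w‖ := norm_nonneg w
  constructor
  · intro h
    have : ‖w‖ ^ 2 = 1 := by rw [h]; norm_num
    rw [Complex.sq_norm, Complex.normSq_apply] at this
    nlinarith [this]
  · intro h
    have h2 : ‖w‖ ^ 2 = 1 := by
      rw [Complex.sq_norm, Complex.normSq_apply]; nlinarith [h]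
    nlinarith [h2, h0]

/-- A complex number whose square is a POSITIVE real is real: `z² = r > 0 ⟹ Im z = 0 ∧ (Re z)² = r`.
[folklore] -/
private theorem im_eq_zero_of_sq_eq {z : ℂ} {r : ℝ} (hr : 0 < r) (h : z ^ 2 = (r : ℂ)) :
    z.im = 0 ∧ z.re ^ 2 = r := by
  have hre : z.re ^ 2 - z.im ^ 2 = r := by
    have := congrArg Complex.re h
    simp [sq, Complex.mul_re] at this
    nlinarith [this]
  have him : 2 * z.re * z.im = 0 := by
    have := congrArg Complex.im h
    simp [sq, Complex.mul_im] at this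
    linarith [this]
  by_cases hz : z.im = 0
  · refine ⟨hz, ?_⟩
    rw [hz] at hre; nlinarith [hre]
  · exfalso
    have hre0 : z.re = 0 := by
      have : 2 * z.re = 0 ∨ z.im = 0 := mul_eq_zero.mp him
      rcases this with h1 | h1
      · linarith
      · exact absurd h1 hz
    rw [hre0] at hre
    nlinarith [hre, sq_nonneg z.im]

/-- **Two-point lemma.** For a pair `w, w'` with `w w' = 1` (the two roots of `X² − yX + 1`,
`y = w + w'`): both are unimodular and distinct iff `y` is real with `y² < 4`. This is the
`x ↦ x + 1/x` correspondence between simple conjugate pairs on `T ∖ {±1}` and points of `(−2, 2)`.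
[folklore] -/
private theorem pair_unimodular_iff {w w' : ℂ} (h : w * w' = 1) :
    (‖w‖ = 1 ∧ ‖w'‖ = 1 ∧ w ≠ w') ↔ ((w + w').im = 0 ∧ (w + w').re ^ 2 < 4) := by
  have hre : w.re * w'.re - w.im * w'.im = 1 := by
    have := congrArg Complex.re h; simpa [Complex.mul_re] using this
  have him : w.re * w'.im + w.im * w'.re = 0 := by
    have := congrArg Complex.im h; simpa [Complex.mul_im] using this
  rw [norm_eq_one_iff_sq, norm_eq_one_iff_sq, Ne, Complex.ext_iff, Complex.add_re, Complex.add_im]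
  constructor
  · rintro ⟨h1, h2, h3⟩
    -- `w' = w⁻¹ = conj w`
    have ha : w'.re = w.re := by
      nlinarith [hre, him, h1, h2, sq_nonneg (w'.re - w.re), sq_nonneg (w'.im + w.im)]
    have hb : w'.im = -w.im := by
      nlinarith [hre, him, h1, h2, sq_nonneg (w'.re - w.re), sq_nonneg (w'.im + w.im)]
    have hbne : w.im ≠ 0 := by
      intro hb0
      apply h3
      constructor
      · rw [ha]
      · rw [hb, hb0]; simp
    refine ⟨by rw [hb]; ring, ?_⟩
    rw [ha]
    have : 0 < w.im ^ 2 := by positivity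
    nlinarith [h1, this]
  · rintro ⟨h1, h2⟩
    have hb : w'.im = -w.im := by linarith
    rw [hb] at hre him
    have hbne : w.im ≠ 0 := by
      intro hb0
      rw [hb0] at hre him hb
      simp at hre
      nlinarith [sq_nonneg (w.re - w'.re), hre, h2]
    have ha : w'.re = w.re := by
      have : w.im * (w'.re - w.re) = 0 := by linarith [him]
      rcases mul_eq_zero.mp this with h3 | h3
      · exact absurd h3 hbne
      · linarith
    rw [ha] at hre h2
    refine ⟨by nlinarith [hre], by rw [ha, hb]; nlinarith [hre], ?_⟩
    intro ⟨_, h4⟩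
    rw [hb] at h4
    apply hbne; linarith

/-- **Cross lemma.** Two pairs `{w₁, w₁'}`, `{w₂, w₂'}` with `w₁w₁' = w₂w₂' = 1` are disjoint iff
their sums differ (a pair with product `1` is determined by its sum). [folklore] -/
private theorem cross_ne_iff {w₁ w₁' w₂ w₂' : ℂ} (h1 : w₁ * w₁' = 1) (h2 : w₂ * w₂' = 1) :
    (w₁ ≠ w₂ ∧ w₁ ≠ w₂' ∧ w₁' ≠ w₂ ∧ w₁' ≠ w₂') ↔ w₁ + w₁' ≠ w₂ + w₂' := by
  constructor
  · rintro ⟨ha, _, hc, _⟩ hsum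
    have key : (w₂ - w₁) * (w₂ - w₁') = 0 := by
      have : (w₂ - w₁) * (w₂ - w₁') = w₂ * w₂ - (w₁ + w₁') * w₂ + w₁ * w₁' := by ring
      rw [this, hsum, h1]; linear_combination (-1 : ℂ) * h2
    rcases mul_eq_zero.mp key with h | h
    · exact ha (sub_eq_zero.mp h).symm
    · exact hc (sub_eq_zero.mp h).symm
  · intro hne
    have inv1 : w₁' = w₁⁻¹ := eq_inv_of_mul_eq_one_right h1
    have inv1b : w₁ = w₁'⁻¹ := eq_inv_of_mul_eq_one_left h1
    have inv2 : w₂' = w₂⁻¹ := eq_inv_of_mul_eq_one_right h2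
    have inv2b : w₂ = w₂'⁻¹ := eq_inv_of_mul_eq_one_left h2
    refine ⟨?_, ?_, ?_, ?_⟩ <;> intro h <;> apply hne
    · rw [inv1, inv2, h]
    · rw [inv1, inv2b, h, add_comm]
    · rw [inv1b, inv2, h, add_comm]
    · rw [inv1b, inv2b, h]

/-- **Real-algebra step for `g = 2`.** For the two (complex) roots `y₁, y₂` of the Joukowski
quadratic `y² − s y + p` (`s, p` real): both real, in `(−2, 2)` and distinct ⟺ the three printed
quotients are positive, namely `(4 − s)/(4 + s)`, `(16 − 2s² + 4p)/(s² − 4p)`, `(4 − 2s + p)/(4 + 2s + p)`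
(these are `R₂, R₃, R₄` of the `g = 2` table at `c = (c₀, −c₀ s, c₀(p + 2))`, see
`GenusTwo.R₂_subst` etc.); the real-algebra core of Thm 2.6 for `g = 2` in this file's route. [folklore] -/
private theorem realPair_iff {s p : ℝ} {y₁ y₂ : ℂ} (hs : y₁ + y₂ = (s : ℂ)) (hp : y₁ * y₂ = (p : ℂ)) :
    ((y₁.im = 0 ∧ y₁.re ^ 2 < 4) ∧ (y₂.im = 0 ∧ y₂.re ^ 2 < 4) ∧ y₁ ≠ y₂) ↔
    (0 < (4 - s) / (4 + s) ∧ 0 < (16 - 2 * s ^ 2 + 4 * p) / (s ^ 2 - 4 * p) ∧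
      0 < (4 - 2 * s + p) / (4 + 2 * s + p)) := by
  have hs_re : y₁.re + y₂.re = s := by
    have := congrArg Complex.re hs; simpa using this
  have hs_im : y₁.im + y₂.im = 0 := by
    have := congrArg Complex.im hs; simpa using this
  have hp_re : y₁.re * y₂.re - y₁.im * y₂.im = p := by
    have := congrArg Complex.re hp; simpa [Complex.mul_re] using this
  constructor
  · rintro ⟨⟨h1i, h1r⟩, ⟨h2i, h2r⟩, hne⟩
    have hsu : s = y₁.re + y₂.re := hs_re.symm
    have hpu : p = y₁.re * y₂.re := by rw [h1i, h2i] at hp_re; linarith [hp_re]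
    have huv : y₁.re ≠ y₂.re := by
      intro h; apply hne
      apply Complex.ext
      · exact h
      · rw [h1i, h2i]
    have hu1 : y₁.re < 2 := by nlinarith [h1r]
    have hu2 : -2 < y₁.re := by nlinarith [h1r]
    have hv1 : y₂.re < 2 := by nlinarith [h2r]
    have hv2 : -2 < y₂.re := by nlinarith [h2r]
    have hd : 0 < (y₁.re - y₂.re) ^ 2 := by
      have : y₁.re - y₂.re ≠ 0 := sub_ne_zero.mpr huv
      positivity
    rw [hsu, hpu]
    refine ⟨div_pos (by linarith) (by linarith), div_pos (by nlinarith) (by nlinarith), ?_⟩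
    apply div_pos
    · have : 4 - 2 * (y₁.re + y₂.re) + y₁.re * y₂.re = (2 - y₁.re) * (2 - y₂.re) := by ring
      rw [this]; exact mul_pos (by linarith) (by linarith)
    · have : 4 + 2 * (y₁.re + y₂.re) + y₁.re * y₂.re = (2 + y₁.re) * (2 + y₂.re) := by ring
      rw [this]; exact mul_pos (by linarith) (by linarith)
  · rintro ⟨hR2, hR3, hR4⟩
    rw [div_pos_iff] at hR2 hR3 hR4
    -- Step 1: `s² < 16` (from `R₂ > 0`)
    have hs16 : s ^ 2 < 16 := by
      rcases hR2 with ⟨h1, h2⟩ | ⟨h1, h2⟩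
      · nlinarith
      · linarith
    -- Step 2: discriminant `D = s² − 4p > 0` and `N = 16 − 2s² + 4p = (16 − s²) − D > 0` (from `R₃ > 0`)
    have hDN : 0 < s ^ 2 - 4 * p ∧ 0 < 16 - 2 * s ^ 2 + 4 * p := by
      rcases hR3 with ⟨h1, h2⟩ | ⟨h1, h2⟩
      · exact ⟨h2, h1⟩
      · exfalso; nlinarith
    obtain ⟨hD, hN⟩ := hDN
    -- Step 3: `(y₁ − y₂)² = D > 0`, so `y₁, y₂` are real
    have hsq : (y₁ - y₂) ^ 2 = ((s ^ 2 - 4 * p : ℝ) : ℂ) := by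
      push_cast
      rw [← hs, ← hp]; ring
    obtain ⟨hdim, hdre⟩ := im_eq_zero_of_sq_eq hD hsq
    rw [Complex.sub_im] at hdim
    rw [Complex.sub_re] at hdre
    have h1i : y₁.im = 0 := by linarith
    have h2i : y₂.im = 0 := by linarith
    rw [h1i, h2i, mul_zero, sub_zero] at hp_re
    -- Step 4: `(4 − y₁²)(4 − y₂²) > 0` (from `R₄ > 0`) and `y₁² + y₂² < 8` (from `N > 0`)
    have hprod : 0 < (4 - 2 * s + p) * (4 + 2 * s + p) := by
      rcases hR4 with ⟨h1, h2⟩ | ⟨h1, h2⟩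
      · exact mul_pos h1 h2
      · exact mul_pos_of_neg_of_neg h1 h2
    have hprod' : 0 < (4 - y₁.re ^ 2) * (4 - y₂.re ^ 2) := by
      have : (4 - y₁.re ^ 2) * (4 - y₂.re ^ 2) = (4 - 2 * s + p) * (4 + 2 * s + p) := by
        rw [← hs_re, ← hp_re]; ring
      rw [this]; exact hprod
    have hN' : y₁.re ^ 2 + y₂.re ^ 2 < 8 := by
      have : 16 - 2 * s ^ 2 + 4 * p = 16 - 2 * (y₁.re ^ 2 + y₂.re ^ 2) := by
        rw [← hs_re, ← hp_re]; ring
      rw [this] at hN; linarith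
    have hu : y₁.re ^ 2 < 4 := by
      by_contra hcon
      rw [not_lt] at hcon
      have hv : y₂.re ^ 2 < 4 := by linarith
      nlinarith [mul_nonneg (sub_nonneg.2 hcon) (sub_nonneg.2 hv.le)]
    have hv : y₂.re ^ 2 < 4 := by
      by_contra hcon
      rw [not_lt] at hcon
      nlinarith [mul_nonneg (sub_nonneg.2 hcon) (sub_nonneg.2 hu.le)]
    have hne : y₁.re ≠ y₂.re := by
      intro h
      rw [h, sub_self] at hdre
      simp at hdre
      linarith
    refine ⟨⟨h1i, hu⟩, ⟨h2i, hv⟩, ?_⟩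
    intro h; exact hne (by rw [h])

/-! ## Genus one: `P₁(x) = c₀(x² + 1) + c₁ x` -/

namespace GenusOne

/-- (def_Pg) for `g = 1`: `P₁(x) = c₀ x² + c₁ x + c₀` (real `c₀, c₁`), as a complex polynomial.
[cite: Suzuki2012SelfReciprocal, §1 (def_Pg), g = 1] -/
def P (c₀ c₁ : ℝ) : ℂ[X] := C (c₀ : ℂ) * X ^ 2 + C (c₁ : ℂ) * X + C (c₀ : ℂ)

/-- The printed table, `g = 1`: `R₂(c₀, c₁) = (2c₀ + c₁)/(2c₀ − c₁)` (and `R₀ = R₁ = 1`).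
[cite: Suzuki2012SelfReciprocal, §2.2, table after Thm 2.6, g = 1] -/
def R₂ (c₀ c₁ : ℝ) : ℝ := (2 * c₀ + c₁) / (2 * c₀ - c₁)

/-- `P₁ = c₀ (X − w)(X − w')` for any Vieta pair `w + w' = −c₁/c₀`, `w w' = 1`.
[folklore] -/
private theorem P_eq_prod {c₀ c₁ : ℝ} {w w' : ℂ}
    (hs : (c₁ : ℂ) = -((c₀ : ℂ) * (w + w'))) (h' : w * w' = 1) :
    P c₀ c₁ = C (c₀ : ℂ) * ((X - C w) * (X - C w')) := by
  rw [← quad_factor, h', P, hs]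
  simp only [map_add, map_mul, map_neg, map_one]
  ring

/-- `P₁ ≠ 0` when `c₀ ≠ 0` (the source's «nonzero polynomial … `c₀ ≠ 0`»). [cite: Suzuki2012SelfReciprocal, §1 (def_Pg), g = 1] -/
theorem P_ne_zero {c₀ : ℝ} (c₁ : ℝ) (h₀ : c₀ ≠ 0) : P c₀ c₁ ≠ 0 := by
  intro h
  have := congrArg (fun Q : ℂ[X] => Q.coeff 0) h
  simp [P] at this
  exact h₀ (by exact_mod_cast this)

/-- The root multiset of `P₁`: `{w, w'}` for the Vieta pair. [folklore] -/
private theorem P_roots {c₀ c₁ : ℝ} {w w' : ℂ} (h₀ : c₀ ≠ 0)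
    (hs : (c₁ : ℂ) = -((c₀ : ℂ) * (w + w'))) (h' : w * w' = 1) :
    (P c₀ c₁).roots = {w, w'} := by
  rw [P_eq_prod hs h', roots_C_mul _ (by exact_mod_cast h₀)]
  have hm1 : ((X - C w) * (X - C w') : ℂ[X]) ≠ 0 :=
    ((monic_X_sub_C w).mul (monic_X_sub_C w')).ne_zero
  rw [roots_mul hm1, roots_X_sub_C, roots_X_sub_C, Multiset.singleton_add]
  simp only [Multiset.insert_eq_cons]

/-- **Theorem 2.6 for `g = 1`.** For real `c₀ ≠ 0`, `c₁`: all zeros of `P₁(x) = c₀(x²+1) + c₁x`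
lie on `T` and are simple ⟺ `R₂(c₀, c₁) = (2c₀ + c₁)/(2c₀ − c₁) > 0` (the printed condition
«`R_n > 0` and `R_n⁻¹ > 0`, `1 ≤ n ≤ 2`» — `R₁ = 1`, and `R⁻¹ > 0 ⟺ R > 0`).
[cite: Suzuki2012SelfReciprocal, Thm 2.6, case g = 1; elementary proof here] -/
theorem onCircleSimple_iff {c₀ : ℝ} (c₁ : ℝ) (h₀ : c₀ ≠ 0) :
    OnCircleSimple (P c₀ c₁) ↔ 0 < R₂ c₀ c₁ := by
  -- coordinates: `c₁ = −c₀ s`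
  obtain ⟨s, rfl⟩ : ∃ s : ℝ, c₁ = -(c₀ * s) := ⟨-c₁ / c₀, by field_simp⟩
  obtain ⟨w, w', hw, hw'⟩ := exists_sum_prod_eq (s : ℂ) 1
  have hs : ((-(c₀ * s) : ℝ) : ℂ) = -((c₀ : ℂ) * (w + w')) := by rw [hw]; push_cast; ring
  have hR : R₂ c₀ (-(c₀ * s)) = (2 - s) / (2 + s) := by
    unfold R₂
    rw [show 2 * c₀ + -(c₀ * s) = c₀ * (2 - s) by ring,
      show 2 * c₀ - -(c₀ * s) = c₀ * (2 + s) by ring]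
    exact mul_div_mul_left _ _ h₀
  rw [hR, OnCircleSimple, P_roots h₀ hs hw']
  have step : ((w ::ₘ {w'} : Multiset ℂ).Nodup ∧ ∀ z ∈ (w ::ₘ {w'} : Multiset ℂ), ‖z‖ = 1) ↔
      (‖w‖ = 1 ∧ ‖w'‖ = 1 ∧ w ≠ w') := by
    simp only [Multiset.nodup_cons, Multiset.mem_singleton, Multiset.nodup_singleton, and_true,
      Multiset.mem_cons, forall_eq_or_imp, forall_eq]
    tauto
  simp only [Multiset.insert_eq_cons]
  rw [step, pair_unimodular_iff hw', hw, Complex.ofReal_im, Complex.ofReal_re, div_pos_iff]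
  constructor
  · rintro ⟨-, h⟩
    left
    constructor <;> nlinarith [h]
  · rintro (⟨h1, h2⟩ | ⟨h1, h2⟩)
    · exact ⟨rfl, by nlinarith⟩
    · exfalso; linarith

end GenusOne

/-! ## Genus two: `P₂(x) = c₀(x⁴ + 1) + c₁(x³ + x) + c₂ x²` -/

namespace GenusTwo

/-- (def_Pg) for `g = 2`: `P₂(x) = c₀x⁴ + c₁x³ + c₂x² + c₁x + c₀` (real `c₀, c₁, c₂`), as a
complex polynomial. [cite: Suzuki2012SelfReciprocal, §1 (def_Pg), g = 2] -/
def P (c₀ c₁ c₂ : ℝ) : ℂ[X] :=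
  C (c₀ : ℂ) * X ^ 4 + C (c₁ : ℂ) * X ^ 3 + C (c₂ : ℂ) * X ^ 2 + C (c₁ : ℂ) * X + C (c₀ : ℂ)

/-- The printed table, `g = 2`: `R₂ = (4c₀ + c₁)/(4c₀ − c₁)` (it does not involve `c₂`).
[cite: Suzuki2012SelfReciprocal, §2.2, table after Thm 2.6, g = 2] -/
def R₂ (c₀ c₁ _c₂ : ℝ) : ℝ := (4 * c₀ + c₁) / (4 * c₀ - c₁)

/-- The printed table, `g = 2`: `R₃ = (8c₀² − 2c₁² + 4c₀c₂)/(8c₀² + c₁² − 4c₀c₂)`.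
[cite: Suzuki2012SelfReciprocal, §2.2, table after Thm 2.6, g = 2] -/
def R₃ (c₀ c₁ c₂ : ℝ) : ℝ :=
  (8 * c₀ ^ 2 - 2 * c₁ ^ 2 + 4 * c₀ * c₂) / (8 * c₀ ^ 2 + c₁ ^ 2 - 4 * c₀ * c₂)

/-- The printed table, `g = 2`: `R₄ = (2c₀ + 2c₁ + c₂)/(2c₀ − 2c₁ + c₂)`.
[cite: Suzuki2012SelfReciprocal, §2.2, table after Thm 2.6, g = 2] -/
def R₄ (c₀ c₁ c₂ : ℝ) : ℝ := (2 * c₀ + 2 * c₁ + c₂) / (2 * c₀ - 2 * c₁ + c₂)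

/-- (rel_mR) with `g = 2`, `n = 1`, `L = log q`: `m₃(c; L) = R₀R₁/(2L) = 1/(2L)` (the convention
(def_mg) `m_{2g} = 1/(g log q)`; it does not involve `c`). [cite: Suzuki2012SelfReciprocal, §2.2 (rel_mR), (def_mg)] -/
def m₃ (_c₀ _c₁ _c₂ L : ℝ) : ℝ := 1 * 1 / (2 * L)

/-- (rel_mR), `g = 2`, `n = 2`: `m₂(c; L) = R₁R₂/(2L)`. [cite: Suzuki2012SelfReciprocal, §2.2 (rel_mR)] -/
def m₂ (c₀ c₁ c₂ L : ℝ) : ℝ := 1 * R₂ c₀ c₁ c₂ / (2 * L)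

/-- (rel_mR), `g = 2`, `n = 3`: `m₁(c; L) = R₂R₃/(2L)`. [cite: Suzuki2012SelfReciprocal, §2.2 (rel_mR)] -/
def m₁ (c₀ c₁ c₂ L : ℝ) : ℝ := R₂ c₀ c₁ c₂ * R₃ c₀ c₁ c₂ / (2 * L)

/-- (rel_mR), `g = 2`, `n = 4`: `m₀(c; L) = R₃R₄/(2L)`. [cite: Suzuki2012SelfReciprocal, §2.2 (rel_mR)] -/
def m₀ (c₀ c₁ c₂ L : ℝ) : ℝ := R₃ c₀ c₁ c₂ * R₄ c₀ c₁ c₂ / (2 * L)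

/-- `P₂ = c₀ (X − w₁)(X − w₁')(X − w₂)(X − w₂')` whenever `y₁ + y₂ = −c₁/c₀`, `y₁y₂ = c₂/c₀ − 2`
(the roots of the Joukowski quadratic `c₀y² + c₁y + (c₂ − 2c₀)`, i.e. `x⁻²P₂(x)` at `y = x + x⁻¹`)
and `wᵢ + wᵢ' = yᵢ`, `wᵢwᵢ' = 1`. [folklore] -/
private theorem P_eq_prod {c₀ c₁ c₂ : ℝ} {y₁ y₂ w₁ w₁' w₂ w₂' : ℂ}
    (hs : (c₁ : ℂ) = -((c₀ : ℂ) * (y₁ + y₂))) (hp : (c₂ : ℂ) = (c₀ : ℂ) * (y₁ * y₂) + 2 * c₀)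
    (h1 : w₁ + w₁' = y₁) (h1' : w₁ * w₁' = 1) (h2 : w₂ + w₂' = y₂) (h2' : w₂ * w₂' = 1) :
    P c₀ c₁ c₂ = C (c₀ : ℂ) * (((X - C w₁) * (X - C w₁')) * ((X - C w₂) * (X - C w₂'))) := by
  rw [← quad_factor, ← quad_factor, h1, h1', h2, h2', P, hs, hp]
  simp only [map_add, map_mul, map_neg, map_one, map_ofNat]
  ring

/-- `P₂ ≠ 0` when `c₀ ≠ 0` (the source's «nonzero polynomial … `c₀ ≠ 0`»). [cite: Suzuki2012SelfReciprocal, §1 (def_Pg), g = 2] -/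
theorem P_ne_zero {c₀ : ℝ} (c₁ c₂ : ℝ) (h₀ : c₀ ≠ 0) : P c₀ c₁ c₂ ≠ 0 := by
  intro h
  have := congrArg (fun Q : ℂ[X] => Q.coeff 0) h
  simp [P] at this
  exact h₀ (by exact_mod_cast this)

/-- The root multiset of `P₂`: `{w₁, w₁', w₂, w₂'}` in the notation of `P_eq_prod`. [folklore] -/
private theorem P_roots {c₀ c₁ c₂ : ℝ} {y₁ y₂ w₁ w₁' w₂ w₂' : ℂ} (h₀ : c₀ ≠ 0)
    (hs : (c₁ : ℂ) = -((c₀ : ℂ) * (y₁ + y₂))) (hp : (c₂ : ℂ) = (c₀ : ℂ) * (y₁ * y₂) + 2 * c₀)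
    (h1 : w₁ + w₁' = y₁) (h1' : w₁ * w₁' = 1) (h2 : w₂ + w₂' = y₂) (h2' : w₂ * w₂' = 1) :
    (P c₀ c₁ c₂).roots = {w₁, w₁', w₂, w₂'} := by
  rw [P_eq_prod hs hp h1 h1' h2 h2', roots_C_mul _ (by exact_mod_cast h₀)]
  have hm1 : ((X - C w₁) * (X - C w₁') : ℂ[X]) ≠ 0 :=
    ((monic_X_sub_C w₁).mul (monic_X_sub_C w₁')).ne_zero
  have hm2 : ((X - C w₂) * (X - C w₂') : ℂ[X]) ≠ 0 :=
    ((monic_X_sub_C w₂).mul (monic_X_sub_C w₂')).ne_zero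
  rw [roots_mul (mul_ne_zero hm1 hm2), roots_mul hm1, roots_mul hm2, roots_X_sub_C, roots_X_sub_C,
    roots_X_sub_C, roots_X_sub_C, add_assoc, Multiset.singleton_add, Multiset.singleton_add,
    Multiset.singleton_add]
  simp only [Multiset.insert_eq_cons]

/-- The table at `c = (c₀, −c₀s, c₀(p+2))`: `R₂ = (4 − s)/(4 + s)`. [folklore] -/
private theorem R₂_subst {c₀ : ℝ} (s p : ℝ) (h₀ : c₀ ≠ 0) :
    R₂ c₀ (-(c₀ * s)) (c₀ * (p + 2)) = (4 - s) / (4 + s) := by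
  unfold R₂
  rw [show 4 * c₀ + -(c₀ * s) = c₀ * (4 - s) by ring,
    show 4 * c₀ - -(c₀ * s) = c₀ * (4 + s) by ring]
  exact mul_div_mul_left _ _ h₀

/-- The table at `c = (c₀, −c₀s, c₀(p+2))`: `R₃ = (16 − 2s² + 4p)/(s² − 4p)`. [folklore] -/
private theorem R₃_subst {c₀ : ℝ} (s p : ℝ) (h₀ : c₀ ≠ 0) :
    R₃ c₀ (-(c₀ * s)) (c₀ * (p + 2)) = (16 - 2 * s ^ 2 + 4 * p) / (s ^ 2 - 4 * p) := by
  unfold R₃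
  have h2 : c₀ ^ 2 ≠ 0 := pow_ne_zero 2 h₀
  rw [show 8 * c₀ ^ 2 - 2 * (-(c₀ * s)) ^ 2 + 4 * c₀ * (c₀ * (p + 2))
        = c₀ ^ 2 * (16 - 2 * s ^ 2 + 4 * p) by ring,
    show 8 * c₀ ^ 2 + (-(c₀ * s)) ^ 2 - 4 * c₀ * (c₀ * (p + 2)) = c₀ ^ 2 * (s ^ 2 - 4 * p) by ring]
  exact mul_div_mul_left _ _ h2

/-- The table at `c = (c₀, −c₀s, c₀(p+2))`: `R₄ = (4 − 2s + p)/(4 + 2s + p)`. [folklore] -/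
private theorem R₄_subst {c₀ : ℝ} (s p : ℝ) (h₀ : c₀ ≠ 0) :
    R₄ c₀ (-(c₀ * s)) (c₀ * (p + 2)) = (4 - 2 * s + p) / (4 + 2 * s + p) := by
  unfold R₄
  rw [show 2 * c₀ + 2 * (-(c₀ * s)) + c₀ * (p + 2) = c₀ * (4 - 2 * s + p) by ring,
    show 2 * c₀ - 2 * (-(c₀ * s)) + c₀ * (p + 2) = c₀ * (4 + 2 * s + p) by ring]
  exact mul_div_mul_left _ _ h₀

/-- Combinatorial step: for a root multiset `{w₁, w₁', w₂, w₂'}` made of two pairs with product `1`,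
«no repetition and all unimodular» ⟺ each pair-sum `yᵢ = wᵢ + wᵢ'` is real with `yᵢ² < 4`, and
`y₁ ≠ y₂`. [folklore] -/
private theorem nodup_unimodular_iff {w₁ w₁' w₂ w₂' : ℂ} (h1' : w₁ * w₁' = 1) (h2' : w₂ * w₂' = 1) :
    (({w₁, w₁', w₂, w₂'} : Multiset ℂ).Nodup ∧ ∀ z ∈ ({w₁, w₁', w₂, w₂'} : Multiset ℂ), ‖z‖ = 1) ↔
    (((w₁ + w₁').im = 0 ∧ (w₁ + w₁').re ^ 2 < 4) ∧ ((w₂ + w₂').im = 0 ∧ (w₂ + w₂').re ^ 2 < 4) ∧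
      w₁ + w₁' ≠ w₂ + w₂') := by
  rw [← pair_unimodular_iff h1', ← pair_unimodular_iff h2', ← cross_ne_iff h1' h2']
  simp only [Multiset.insert_eq_cons, Multiset.nodup_cons, Multiset.mem_cons,
    Multiset.mem_singleton, Multiset.nodup_singleton, and_true, forall_eq_or_imp, forall_eq, not_or]
  tauto

/-- **Theorem 2.6 for `g = 2`.** For real `c₀ ≠ 0`, `c₁`, `c₂`: all zeros of
`P₂(x) = c₀(x⁴+1) + c₁(x³+x) + c₂x²` lie on `T` and are simple ⟺ `R₂ > 0`, `R₃ > 0`, `R₄ > 0`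
for the printed `R₂ = (4c₀+c₁)/(4c₀−c₁)`, `R₃ = (8c₀²−2c₁²+4c₀c₂)/(8c₀²+c₁²−4c₀c₂)`,
`R₄ = (2c₀+2c₁+c₂)/(2c₀−2c₁+c₂)` (the printed condition «`R_n > 0` and `R_n⁻¹ > 0`, `1 ≤ n ≤ 4`» —
`R₁ = 1`, and `R⁻¹ > 0 ⟺ R > 0`; a vanishing denominator makes the quotient `0` in Lean, matching
the source's «finite positive» reading). [cite: Suzuki2012SelfReciprocal, Thm 2.6, case g = 2; elementary proof here via y = x + 1/x] -/
theorem onCircleSimple_iff {c₀ : ℝ} (c₁ c₂ : ℝ) (h₀ : c₀ ≠ 0) :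
    OnCircleSimple (P c₀ c₁ c₂) ↔ 0 < R₂ c₀ c₁ c₂ ∧ 0 < R₃ c₀ c₁ c₂ ∧ 0 < R₄ c₀ c₁ c₂ := by
  -- coordinates: `c₁ = −c₀ s`, `c₂ = c₀ (p + 2)`
  obtain ⟨s, rfl⟩ : ∃ s : ℝ, c₁ = -(c₀ * s) := ⟨-c₁ / c₀, by field_simp⟩
  obtain ⟨p, rfl⟩ : ∃ p : ℝ, c₂ = c₀ * (p + 2) := ⟨c₂ / c₀ - 2, by field_simp; ring⟩
  -- the Joukowski roots and the two Vieta pairs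
  obtain ⟨y₁, y₂, hy, hy'⟩ := exists_sum_prod_eq (s : ℂ) (p : ℂ)
  obtain ⟨w₁, w₁', hw1, hw1'⟩ := exists_sum_prod_eq y₁ 1
  obtain ⟨w₂, w₂', hw2, hw2'⟩ := exists_sum_prod_eq y₂ 1
  have hs : ((-(c₀ * s) : ℝ) : ℂ) = -((c₀ : ℂ) * (y₁ + y₂)) := by rw [hy]; push_cast; ring
  have hp : ((c₀ * (p + 2) : ℝ) : ℂ) = (c₀ : ℂ) * (y₁ * y₂) + 2 * c₀ := by rw [hy']; push_cast; ring
  rw [R₂_subst s p h₀, R₃_subst s p h₀, R₄_subst s p h₀, OnCircleSimple,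
    P_roots h₀ hs hp hw1 hw1' hw2 hw2', nodup_unimodular_iff hw1' hw2', hw1, hw2]
  exact realPair_iff hy hy'

/-- The printed form of Theorem 2.6 (`g = 2`): «`R_n(c) > 0` and `R_n(c)⁻¹ > 0` for every
`1 ≤ n ≤ 4`» with `R₁ = 1`. [cite: Suzuki2012SelfReciprocal, Thm 2.6, case g = 2, as printed] -/
theorem onCircleSimple_iff_printed {c₀ : ℝ} (c₁ c₂ : ℝ) (h₀ : c₀ ≠ 0) :
    OnCircleSimple (P c₀ c₁ c₂) ↔
      ((0 : ℝ) < 1 ∧ (0 : ℝ) < 1⁻¹) ∧ (0 < R₂ c₀ c₁ c₂ ∧ 0 < (R₂ c₀ c₁ c₂)⁻¹) ∧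
        (0 < R₃ c₀ c₁ c₂ ∧ 0 < (R₃ c₀ c₁ c₂)⁻¹) ∧ (0 < R₄ c₀ c₁ c₂ ∧ 0 < (R₄ c₀ c₁ c₂)⁻¹) := by
  rw [onCircleSimple_iff c₁ c₂ h₀]
  simp only [inv_pos, and_self, inv_one, zero_lt_one, true_and]

/-- **Theorem 2.4 for `g = 2`** (the Hamiltonian form): for `q > 1` (`L = log q > 0`), all zeros of
`P₂` lie on `T` and are simple ⟺ `m_{2g−n}(c; log q) > 0` for `n = 1, …, 4`, with the `m`'s given by
(rel_mR) from the printed table (and then automatically `m⁻¹ > 0`). The source derives Thm 2.6 from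
Thm 2.4 by exactly this sign bookkeeping (`R₀ = 1 > 0`, consecutive `R`'s share signs).
[cite: Suzuki2012SelfReciprocal, Thm 2.4, case g = 2, with (rel_mR)] -/
theorem onCircleSimple_iff_m_pos {c₀ : ℝ} (c₁ c₂ : ℝ) (h₀ : c₀ ≠ 0) {L : ℝ} (hL : 0 < L) :
    OnCircleSimple (P c₀ c₁ c₂) ↔
      0 < m₃ c₀ c₁ c₂ L ∧ 0 < m₂ c₀ c₁ c₂ L ∧ 0 < m₁ c₀ c₁ c₂ L ∧ 0 < m₀ c₀ c₁ c₂ L := by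
  rw [onCircleSimple_iff c₁ c₂ h₀]
  have h2L : 0 < 2 * L := by linarith
  simp only [m₃, m₂, m₁, m₀, one_mul, div_pos_iff_of_pos_right h2L, zero_lt_one, true_and]
  constructor
  · rintro ⟨h2, h3, h4⟩
    exact ⟨h2, mul_pos h2 h3, mul_pos h3 h4⟩
  · rintro ⟨h2, h23, h34⟩
    have h3 : 0 < R₃ c₀ c₁ c₂ := (mul_pos_iff_of_pos_left h2).mp h23
    exact ⟨h2, h3, (mul_pos_iff_of_pos_left h3).mp h34⟩

/-! ### Remark 3: the control example `c = (4, −16, 23)` -/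

/-- Remark 3, the `R`-values of `P₂(x) = 4(x⁴+1) − 16(x³+x) + 23x²`: `R₂ = 0`, `R₃ = −1`,
`R₄ = −1/63` (exact). [cite: Suzuki2012SelfReciprocal, Remark 3 (values from the printed table)] -/
theorem R_example : R₂ 4 (-16) 23 = 0 ∧ R₃ 4 (-16) 23 = -1 ∧ R₄ 4 (-16) 23 = -1 / 63 := by
  refine ⟨?_, ?_, ?_⟩ <;> norm_num [R₂, R₃, R₄]

/-- Remark 3 AS PRINTED: `m₃ = (2 log q)⁻¹`, `m₂ = m₁ = 0`, `m₀ = (126 log q)⁻¹` for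
`c = (4, −16, 23)` (`L = log q`). [cite: Suzuki2012SelfReciprocal, Remark 3] -/
theorem m_example (L : ℝ) :
    m₃ 4 (-16) 23 L = (2 * L)⁻¹ ∧ m₂ 4 (-16) 23 L = 0 ∧ m₁ 4 (-16) 23 L = 0 ∧
      m₀ 4 (-16) 23 L = (126 * L)⁻¹ := by
  refine ⟨?_, ?_, ?_, ?_⟩
  · rw [m₃]; ring
  · rw [m₂, R_example.1]; ring
  · rw [m₁, R_example.1]; ring
  · rw [m₀, R_example.2.1, R_example.2.2]; ring

/-- Remark 3: `P₂(x) = 4(x⁴+1) − 16(x³+x) + 23x² = (2x²−3x+2)(2x²−5x+2)` has the zero `x = 2`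
(off `T`). [cite: Suzuki2012SelfReciprocal, Remark 3] -/
theorem isRoot_two_example : (P 4 (-16) 23).IsRoot 2 := by
  simp only [P, IsRoot.def, eval_add, eval_mul, eval_C, eval_pow, eval_X]
  push_cast
  norm_num

/-- Remark 3, the printed factorisation: `4(x⁴+1) − 16(x³+x) + 23x² = (2x² − 3x + 2)(2x² − 5x + 2)`.
[cite: Suzuki2012SelfReciprocal, Remark 3] -/
theorem P_example_eq : P 4 (-16) 23 = (2 * X ^ 2 - 3 * X + 2) * (2 * X ^ 2 - 5 * X + 2) := by
  simp only [P]
  push_cast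
  simp only [map_ofNat, map_neg]
  ring

/-- Remark 3, the conclusion: NOT all zeros of `4(x⁴+1) − 16(x³+x) + 23x²` lie on `T` — consistent
with Theorem 2.6 (`R₂ = 0` is not positive) although `m₃, m₀ > 0` and `m₂ = m₁ = 0` are all `≥ 0`:
«the strict inequalities are essential». [cite: Suzuki2012SelfReciprocal, Remark 3] -/
theorem not_onCircleSimple_example : ¬ OnCircleSimple (P 4 (-16) 23) := by
  rw [onCircleSimple_iff (-16) 23 (by norm_num : (4 : ℝ) ≠ 0), R_example.1]
  simp

end GenusTwo

end SuzukiSelfReciprocal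

end Literature.Algebra.Polynomial
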